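import Summits.QuantumFields.YangMills.Theorems.UnitScaleTiltHalvingP1FlatCoreTopStepTraceFree
import Summits.QuantumFields.YangMills.Theorems.UnitScaleTiltHalvingP1FlatCoreTopStepFamily
import Literature.MathematicalPhysics.QuantumFieldTheory.Balaban1983to89.B8SectEKLevelFamilyHc
import HarnessLib

/-!
# `UnitScaleTiltHalvingP1FlatCoreTopStepFamilyTraceFree` — line H (`BirthV10.stub_halvingStep`, stmt-QuantumFields-19200), LEAD-H RULING L-10 (τ-2):
# the τ-TWIN of ✓p632037 `HalvingP1FlatCoreTopStep.hFP_kLevel_family_RD` — PROPOSITION 5's k-LEVEL STEP WITH THE MIXED RESTRICTION FUNCTIONAL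
# `Qfull = Qlin + Cfam` AND AN INHOMOGENEOUS TARGET `t̂`, WITH THE GAUGE PARAMETER `λ′` `τ`-FREE AT EVERY SITE for every continuous tracial `τ`:
# the Sect.-E family's correction `H_c λ = i(H′t̂ − H′D′(−iλ + H′t̂))` (★w8-19936 s2's ✓`B8SectEKLevelFamilyHc.exists_Hc_of_family`) maps `τ`-free
# parameters to `τ`-free configurations (r05's invariant-closed-set device ✓`B8SectEKLevelFamily.eq1117_solution_mem_of_invariant_fam` at
# `S := {X | ∀ p, τ(X p) = 0}`), and the restriction-agnostic τ-JOIN-B (`…TopStepTraceFree.hFP_kLevel_ofConstraint_RD_traceFree`) composes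

WHY (cell `ym3-torus`; LEAD-H ★w5-19200 g4 RULING L-10 15:07:50Z + AMENDMENT 15:08:14Z; τ-thread (τ-1) ★w1-20520 g7 ∥ (τ-2) ★w7-19936 g8 → (τ-3) ★w8-19936 g3).
The located [R-f]-TRACELESS gap of the H-line's nine content rows (✓p643656 `hSup_of_contentRows`): ✓p636261 `hFP_kLevel_top_RD` yields `IsSelfAdjoint (lam x)` only,
while `hug`'s left side is `SU(2)`-valued — so the τ-clause is carried UP the Prop.-5 ladder (lit base ✓`B8Prop5JoinSectELocalRDTraceFree` → agnostic-τ (sibling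
file) → family-τ (THIS FILE) → top-τ (τ-3)).  THIS FILE:
* §1 ★ `eq1117_solution_traceFree_fam` — ANY solution `X` of (1.117) in Sect. E's ball at the SHIFTED base point `−iλ_s + H′t̂` (`λ_s` in the ¼α₄-ball, `τ`-free;
  `t̂` `τ`-free; `H′` `τ`-compatible; the family's `τ`-row `hCτ` on the (1.120)-set of every tower) is `τ`-free: `∀ p, τ (X p) = 0` — the `_fam` sibling of lit
  ✓`B8SectETraceFree.sectE_traceFree` (same closed invariant set, `base_sub_119` for the shifted base point, `dom120_of_119_tower` for the (1.120) antecedents);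
* §2 ★ `exists_Hc_of_family_traceFree` — ✓`exists_Hc_of_family` VERBATIM (the eight JOIN binders and the transfer clause) PLUS the ninth clause
  `hcτ : ‖s‖ ≤ ¼α₄ → (∀ x, τ (λ_s x) = 0) → ∀ x, τ (H_c λ_s x) = 0` — read off the transfer clause (`H_c λ_s = i·(H′t̂ − H′X_s)`) and §1, no re-run of the eight;
* §3 ★★ `hFP_kLevel_family_RD_traceFree` — ✓`hFP_kLevel_family_RD`'s binders VERBATIM + `τ` tracial + the τ-rows {`hDAτ`, `hRτ`, `hGτ` of the lit base; `hHτ`, `hthτ`, `hCτ`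
  of §1}; CONCLUSION = the non-τ one with **`(∀ x, τ (λ′ x) = 0)`** inserted after the support clause.  `hCτ`'s letters = lit ✓`sectE_traceFree`'s with
  `Cnl L U₀ u₁⁻¹ j ↦ Cfam j` (μ `τ`-free at EVERY site, then the two (1.120) antecedents on the `(j, y)`-box) — the row (τ-1) discharges it at the top, print's rows below.
HONEST FRAMING.  By-name composition; every analytic input stays DISPLAYED ([4]'s letters and `H′` rows, the family's rows, the datum, the windows, the τ-rows); nothing of
[4], of [3] Prop. 10, of Sect. E's estimates, of the tower induction or of the τ-rows themselves is proved here.  Count-neutral helper (`--supports stmt-QuantumFields-19200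
--as helper`); registry∕binders∕skeleton text untouched (J r4).  YM₃ on T³ = rung R3, NOT the Clay problem; nothing here proves `hSupU`, the stub, the crux or a mass gap.

References: T. Bałaban, Commun. Math. Phys. 99 (1985) 75–102 [Balaban1985RegularSpaces] (Prop. 5 (1.107)–(1.109) p.94, (1.113)–(1.121) pp.95–97, (1.92) p.91, (1.17) p.78,
p.76); Commun. Math. Phys. 98 (1985) 17–51 [Balaban1985Averaging] (p.19, (213)–(214) p.50).
-/

set_option autoImplicit false

noncomputable section

open NormedSpace Metric Set
open Complex (I)

namespace Summit.QuantumFields.YangMills.Theorems.HalvingP1FlatCoreTopStep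

open Literature.MathematicalPhysics.QuantumFieldTheory.Balaban1983to89
open B7Prop1Explicit (e)
open B7Prop2Explicit (unitaryUnits)
open B7Eq78Linearization (conjR)
open B7Eq170Flat (cj)
open B7Prop1Local (InBox)
open B8Ineq130 (tlo thi)
open B8Ineq132 (covDerivFwd)
open B8Eq138LandauZd (covLap covDivB QT)
open B8Eq182Proof (gAd)
open B8Eq184Proof (gaugeExp)
open B8Eq188Proof (frakF3)
open B8Eq1117Concrete (XSpace)
open B8Eq1117KLevel (dom120_of_119_tower)
open B8LambdaSpaceKLevel (wt lamSubK lamOf)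
open B8Prop5ContractionKLevel (Bd2 Mc Kc)
open B8Prop5JoinSectE (hH1_tower)
open B8SectEKLevelFamily (eq1114_of_fixedPoint_kLevel_fam eq1117_solution_mem_of_invariant_fam)
open B8SectEKLevelFamilyBase (base_sub_119)
open B8SectEKLevelFamilyHc (exists_Hc_of_family)

-- `Site` alone could resolve to the torus sites of `Setup.lean`; use the `ℤ^d` sites of `B7Prop1Explicit`.
open B7Prop1Explicit (Site)

variable {d : ℕ} {𝔸 : Type*} [CStarAlgebra 𝔸] [Nontrivial 𝔸]

variable {L k : ℕ} {η : ℝ} {Ω Λs : ℕ → Set (Site d)} {Eb : ℕ → Set (Site d × Fin d)} {U₀ : Site d → Fin d → 𝔸ˣ}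
  {A : Site d → Fin d → 𝔸}

/-! ## §1 Any solution of (1.117) at the shifted base point is `τ`-free -/

section SolutionTraceFree

variable {α₄ B₀' Cb Cl : ℝ} {Cfam : ℕ → (Site d → 𝔸) → Site d → 𝔸}

omit [Nontrivial 𝔸] in
/-- ★ **THE SOLUTION OF (1.117) AT THE SHIFTED BASE POINT `−iλ_s + H′t̂` IS `τ`-FREE** (the `_fam` sibling of lit `B8SectETraceFree.sectE_traceFree`): for a continuous
linear `τ`, `λ_s` in the ¼α₄-ball with `τ(λ_s(x)) = 0` at every site, a `τ`-free target `t̂`, `H′` mapping `τ`-free families to `τ`-free configurations, and the remainder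
family's `τ`-row on the (1.120)-set of every tower, EVERY `X` in Sect. E's ball `‖X‖ ≤ α₄∕(2B′₀)`, zero off `𝔅_k` and solving (1.117) on `𝔅_k`, has `τ(X p) = 0` for all `p`
— the closed set `{X | ∀ p, τ (X p) = 0} ∋ 0` is invariant under the masked (1.118) (`eq1117_solution_mem_of_invariant_fam`).
[cite: Balaban1985RegularSpaces, (1.117)–(1.121) pp.96–97, (1.17) p.78, p.76] -/
theorem eq1117_solution_traceFree_fam (hL : 1 ≤ L) (hη : 0 < η) (H' : XSpace d k 𝔸 →ₗ[ℂ] (Site d → 𝔸))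
    (hα₄ : 0 < α₄) (hB : 0 < B₀') (hCb : 0 ≤ Cb)
    (hEbT : ∀ j, j ≤ k → ∀ y ∈ Λs j, ∀ (x : Site d) (κ : Fin d), InBox (tlo L y j) (thi L y j) x →
      InBox (tlo L y j) (thi L y j) (x + e κ) → (x, κ) ∈ Eb j)
    (hH0 : ∀ (X : XSpace d k 𝔸) (x : Site d), ‖H' X x‖ ≤ B₀' * ‖X‖)
    (hH1 : ∀ j, j ≤ k → ∀ (X : XSpace d k 𝔸), ∀ p ∈ Eb j, wt L η j * ‖covDerivFwd η U₀ p.2 (H' X) p.1‖ ≤ B₀' * ‖X‖)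
    (hC121 : ∀ j, j ≤ k → ∀ y ∈ Λs j, ∀ μ : Site d → 𝔸,
      (∀ x : Site d, InBox (tlo L y j) (thi L y j) x → ‖μ x‖ < α₄) →
      (∀ (x : Site d) (κ : Fin d), InBox (tlo L y j) (thi L y j) x → InBox (tlo L y j) (thi L y j) (x + e κ) →
        ‖cj (U₀ x κ) (μ (x + e κ)) - μ x‖ < α₄ * ((L : ℝ) ^ j)⁻¹) →
      ‖Cfam j μ y‖ ≤ Cb)
    (hC125 : ∀ j, j ≤ k → ∀ y ∈ Λs j, ∀ (μ₁ μ₂ : Site d → 𝔸) (m : ℝ), 0 ≤ m →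
      (∀ x : Site d, InBox (tlo L y j) (thi L y j) x → ‖μ₁ x‖ < α₄) →
      (∀ (x : Site d) (κ : Fin d), InBox (tlo L y j) (thi L y j) x → InBox (tlo L y j) (thi L y j) (x + e κ) →
        ‖cj (U₀ x κ) (μ₁ (x + e κ)) - μ₁ x‖ < α₄ * ((L : ℝ) ^ j)⁻¹) →
      (∀ x : Site d, InBox (tlo L y j) (thi L y j) x → ‖μ₂ x‖ < α₄) →
      (∀ (x : Site d) (κ : Fin d), InBox (tlo L y j) (thi L y j) x → InBox (tlo L y j) (thi L y j) (x + e κ) →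
        ‖cj (U₀ x κ) (μ₂ (x + e κ)) - μ₂ x‖ < α₄ * ((L : ℝ) ^ j)⁻¹) →
      (∀ x : Site d, InBox (tlo L y j) (thi L y j) x → ‖(μ₁ - μ₂) x‖ ≤ m) →
      (∀ (x : Site d) (κ : Fin d), InBox (tlo L y j) (thi L y j) x → InBox (tlo L y j) (thi L y j) (x + e κ) →
        ‖cj (U₀ x κ) ((μ₁ - μ₂) (x + e κ)) - (μ₁ - μ₂) x‖ ≤ m * ((L : ℝ) ^ j)⁻¹) →
      ‖Cfam j μ₁ y - Cfam j μ₂ y‖ ≤ Cl * m)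
    (hCbρ : Cb ≤ α₄ / (2 * B₀')) (hClB : Cl * B₀' ≤ 1 / 2)
    (th : XSpace d k 𝔸) (hτ : B₀' * ‖th‖ < α₄ / 4)
    -- `τ` and the τ-rows
    (τ : 𝔸 →L[ℂ] ℂ)
    (hHτ : ∀ X : XSpace d k 𝔸, (∀ p, τ (X p) = 0) → ∀ x, τ (H' X x) = 0)
    (hthτ : ∀ p, τ (th p) = 0)
    (hCτ : ∀ j, j ≤ k → ∀ y ∈ Λs j, ∀ μ : Site d → 𝔸, (∀ x, τ (μ x) = 0) →
      (∀ x : Site d, InBox (tlo L y j) (thi L y j) x → ‖μ x‖ < α₄) →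
      (∀ (x : Site d) (κ : Fin d), InBox (tlo L y j) (thi L y j) x → InBox (tlo L y j) (thi L y j) (x + e κ) →
        ‖cj (U₀ x κ) (μ (x + e κ)) - μ x‖ < α₄ * ((L : ℝ) ^ j)⁻¹) →
      τ (Cfam j μ y) = 0)
    (s : lamSubK η U₀ L k Eb) (hs : ‖s‖ ≤ α₄ / 4) (hsτ : ∀ x, τ (lamOf s x) = 0)
    {X : XSpace d k 𝔸} (hXρ : ‖X‖ ≤ α₄ / (2 * B₀'))
    (hXzero : ∀ (j : ℕ) (hj : j ≤ k) (y : Site d), y ∉ Λs j → X (⟨j, Nat.lt_succ_of_le hj⟩, y) = 0)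
    (hXfix : ∀ (j : ℕ) (hj : j ≤ k) (y : Site d), y ∈ Λs j →
      Cfam j (((-I) • lamOf s + H' th) - H' X) y = X (⟨j, Nat.lt_succ_of_le hj⟩, y)) :
    ∀ p, τ (X p) = 0 := by
  obtain ⟨h119b, h119a⟩ := base_sub_119 (Λs := Λs) hL hη H' hEbT hH0 hH1 th hτ s hs
  have hH1t := hH1_tower hL hη H' hEbT hH1
  set S : Set (XSpace d k 𝔸) := {X | ∀ p, τ (X p) = 0} with hS_def
  have hS : IsClosed S := by
    have hS' : S = ⋂ p : Fin (k + 1) × Site d, {X : XSpace d k 𝔸 | τ (X p) = 0} := by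
      ext X; simp only [hS_def, Set.mem_setOf_eq, Set.mem_iInter]
    rw [hS']
    exact isClosed_iInter fun p =>
      isClosed_eq (τ.continuous.comp (continuous_eval_const p)) continuous_const
  have h0 : (0 : XSpace d k 𝔸) ∈ S := fun p => by simp
  have hbase : ∀ x, τ (((-I) • lamOf s + H' th) x) = 0 := fun x => by
    rw [Pi.add_apply, Pi.smul_apply, map_add, map_smul, hsτ x, hHτ th hthτ x, smul_zero, add_zero]
  have hinv : ∀ X ∈ S, ‖X‖ ≤ α₄ / (2 * B₀') → ∀ Y : XSpace d k 𝔸,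
      (∀ p : Fin (k + 1) × Site d,
        (p.2 ∈ Λs p.1 → Y p = Cfam p.1 (((-I) • lamOf s + H' th) - H' X) p.2) ∧ (p.2 ∉ Λs p.1 → Y p = 0)) →
      Y ∈ S := by
    intro X hX hXρ' Y hY p
    obtain ⟨h1, h2⟩ := hY p
    by_cases hp : p.2 ∈ Λs p.1
    · rw [h1 hp]
      have hj : (p.1 : ℕ) ≤ k := Nat.le_of_lt_succ p.1.isLt
      obtain ⟨ha, hb⟩ := dom120_of_119_tower H' hB (by positivity) hH0 (hH1t p.1 hj p.2 hp) (h119a p.1 hj p.2 hp)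
        (h119b p.1 hj p.2 hp) hXρ'
      refine hCτ p.1 hj p.2 hp _ (fun x => ?_) hb ha
      rw [Pi.sub_apply, map_sub, hbase x, hHτ X hX x, sub_zero]
    · rw [h2 hp, map_zero]
  exact eq1117_solution_mem_of_invariant_fam (Λ := Λs) (lam := (-I) • lamOf s + H' th) (H' := H') (Cfam := Cfam) hα₄ hB hCb h119b h119a
    hH0 hH1t hC121 hC125 hCbρ hClB S hS h0 hinv hXρ hXzero hXfix

end SolutionTraceFree

/-! ## §2 The Sect.-E family's correction `H_c` with its eight JOIN binders, the transfer clause, AND the τ-clause -/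

section HcTraceFree

variable {α₄ B₀' B₂' Cb Cl : ℝ} {Cfam : ℕ → (Site d → 𝔸) → Site d → 𝔸}

omit [Nontrivial 𝔸] in
/-- ★ **`exists_Hc_of_family` WITH THE τ-CLAUSE**: the same letter `Hc` (eight JOIN binders at the Sect.-E sizes, reality, support, transfer clause) and, ninth,
`hcτ`: for `λ_s` in the ¼α₄-ball with `τ(λ_s(x)) = 0` everywhere, `τ(H_cλ_s(x)) = 0` everywhere — since `H_cλ_s = i·(H′t̂ − H′X_s)` with `X_s` a solution of (1.117)
at the shifted base point (`eq1117_solution_traceFree_fam`) and `H′`, `t̂` `τ`-compatible. [cite: Balaban1985RegularSpaces, (1.113)–(1.121) pp.95–97, (1.92) p.91, (1.17) p.78] -/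
theorem exists_Hc_of_family_traceFree (hL : 1 ≤ L) (hη : 0 < η) (H' : XSpace d k 𝔸 →ₗ[ℂ] (Site d → 𝔸))
    (hα₄ : 0 < α₄) (hB : 0 < B₀') (hB₂ : 0 ≤ B₂') (hCb : 0 ≤ Cb) (hCl : 0 ≤ Cl)
    (hEbT : ∀ j, j ≤ k → ∀ y ∈ Λs j, ∀ (x : Site d) (κ : Fin d), InBox (tlo L y j) (thi L y j) x →
      InBox (tlo L y j) (thi L y j) (x + e κ) → (x, κ) ∈ Eb j)
    (hH0 : ∀ (X : XSpace d k 𝔸) (x : Site d), ‖H' X x‖ ≤ B₀' * ‖X‖)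
    (hH1 : ∀ j, j ≤ k → ∀ (X : XSpace d k 𝔸), ∀ p ∈ Eb j, wt L η j * ‖covDerivFwd η U₀ p.2 (H' X) p.1‖ ≤ B₀' * ‖X‖)
    (hH2 : ∀ X : XSpace d k 𝔸, Bd2 L η k Ω (covLap η U₀ (H' X)) (B₂' * ‖X‖))
    (hHsupp : ∀ (X : XSpace d k 𝔸) (x : Site d), x ∉ Ω 0 → H' X x = 0)
    (hHequiv : ∀ X Y : XSpace d k 𝔸, (∀ p, Y p = -star (X p)) → ∀ x, H' Y x = -star (H' X x))
    (hC121 : ∀ j, j ≤ k → ∀ y ∈ Λs j, ∀ μ : Site d → 𝔸,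
      (∀ x : Site d, InBox (tlo L y j) (thi L y j) x → ‖μ x‖ < α₄) →
      (∀ (x : Site d) (κ : Fin d), InBox (tlo L y j) (thi L y j) x → InBox (tlo L y j) (thi L y j) (x + e κ) →
        ‖cj (U₀ x κ) (μ (x + e κ)) - μ x‖ < α₄ * ((L : ℝ) ^ j)⁻¹) →
      ‖Cfam j μ y‖ ≤ Cb)
    (hC125 : ∀ j, j ≤ k → ∀ y ∈ Λs j, ∀ (μ₁ μ₂ : Site d → 𝔸) (m : ℝ), 0 ≤ m →
      (∀ x : Site d, InBox (tlo L y j) (thi L y j) x → ‖μ₁ x‖ < α₄) →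
      (∀ (x : Site d) (κ : Fin d), InBox (tlo L y j) (thi L y j) x → InBox (tlo L y j) (thi L y j) (x + e κ) →
        ‖cj (U₀ x κ) (μ₁ (x + e κ)) - μ₁ x‖ < α₄ * ((L : ℝ) ^ j)⁻¹) →
      (∀ x : Site d, InBox (tlo L y j) (thi L y j) x → ‖μ₂ x‖ < α₄) →
      (∀ (x : Site d) (κ : Fin d), InBox (tlo L y j) (thi L y j) x → InBox (tlo L y j) (thi L y j) (x + e κ) →
        ‖cj (U₀ x κ) (μ₂ (x + e κ)) - μ₂ x‖ < α₄ * ((L : ℝ) ^ j)⁻¹) →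
      (∀ x : Site d, InBox (tlo L y j) (thi L y j) x → ‖(μ₁ - μ₂) x‖ ≤ m) →
      (∀ (x : Site d) (κ : Fin d), InBox (tlo L y j) (thi L y j) x → InBox (tlo L y j) (thi L y j) (x + e κ) →
        ‖cj (U₀ x κ) ((μ₁ - μ₂) (x + e κ)) - (μ₁ - μ₂) x‖ ≤ m * ((L : ℝ) ^ j)⁻¹) →
      ‖Cfam j μ₁ y - Cfam j μ₂ y‖ ≤ Cl * m)
    (hCreal : ∀ j, j ≤ k → ∀ y ∈ Λs j, ∀ μ : Site d → 𝔸,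
      (∀ x : Site d, InBox (tlo L y j) (thi L y j) x → ‖μ x‖ < α₄) →
      (∀ (x : Site d) (κ : Fin d), InBox (tlo L y j) (thi L y j) x → InBox (tlo L y j) (thi L y j) (x + e κ) →
        ‖cj (U₀ x κ) (μ (x + e κ)) - μ x‖ < α₄ * ((L : ℝ) ^ j)⁻¹) →
      Cfam j (fun x => -star (μ x)) y = -star (Cfam j μ y))
    (hCbρ : Cb ≤ α₄ / (2 * B₀')) (hClB : Cl * B₀' ≤ 1 / 2)
    (th : XSpace d k 𝔸) (hτ : B₀' * ‖th‖ < α₄ / 4) (hth : ∀ p, star (th p) = -th p)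
    -- `τ` and the τ-rows
    (τ : 𝔸 →L[ℂ] ℂ)
    (hHτ : ∀ X : XSpace d k 𝔸, (∀ p, τ (X p) = 0) → ∀ x, τ (H' X x) = 0)
    (hthτ : ∀ p, τ (th p) = 0)
    (hCτ : ∀ j, j ≤ k → ∀ y ∈ Λs j, ∀ μ : Site d → 𝔸, (∀ x, τ (μ x) = 0) →
      (∀ x : Site d, InBox (tlo L y j) (thi L y j) x → ‖μ x‖ < α₄) →
      (∀ (x : Site d) (κ : Fin d), InBox (tlo L y j) (thi L y j) x → InBox (tlo L y j) (thi L y j) (x + e κ) →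
        ‖cj (U₀ x κ) (μ (x + e κ)) - μ x‖ < α₄ * ((L : ℝ) ^ j)⁻¹) →
      τ (Cfam j μ y) = 0) :
    ∃ Hc : (Site d → 𝔸) → (Site d → 𝔸),
      (∀ s : lamSubK η U₀ L k Eb, ‖s‖ ≤ α₄ / 4 → ∀ x, ‖Hc (lamOf s) x‖ ≤ B₀' * (Cb + ‖th‖)) ∧
      (∀ s : lamSubK η U₀ L k Eb, ‖s‖ ≤ α₄ / 4 → ∀ j, j ≤ k → ∀ p ∈ Eb j,
        wt L η j * ‖covDerivFwd η U₀ p.2 (Hc (lamOf s)) p.1‖ ≤ B₀' * (Cb + ‖th‖)) ∧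
      (∀ s : lamSubK η U₀ L k Eb, ‖s‖ ≤ α₄ / 4 → Bd2 L η k Ω (covLap η U₀ (Hc (lamOf s))) (B₂' * (Cb + ‖th‖))) ∧
      (∀ s t : lamSubK η U₀ L k Eb, ‖s‖ ≤ α₄ / 4 → ‖t‖ ≤ α₄ / 4 → ∀ x,
        ‖Hc (lamOf s) x - Hc (lamOf t) x‖ ≤ (B₀' * (2 * Cl)) * ‖s - t‖) ∧
      (∀ s t : lamSubK η U₀ L k Eb, ‖s‖ ≤ α₄ / 4 → ‖t‖ ≤ α₄ / 4 → ∀ j, j ≤ k → ∀ p ∈ Eb j,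
        wt L η j * ‖covDerivFwd η U₀ p.2 (Hc (lamOf s) - Hc (lamOf t)) p.1‖ ≤ (B₀' * (2 * Cl)) * ‖s - t‖) ∧
      (∀ s t : lamSubK η U₀ L k Eb, ‖s‖ ≤ α₄ / 4 → ‖t‖ ≤ α₄ / 4 →
        Bd2 L η k Ω (covLap η U₀ (Hc (lamOf s)) - covLap η U₀ (Hc (lamOf t))) ((B₂' * (2 * Cl)) * ‖s - t‖)) ∧
      (∀ s : lamSubK η U₀ L k Eb, ‖s‖ ≤ α₄ / 4 → (∀ x, IsSelfAdjoint (lamOf s x)) → ∀ x, IsSelfAdjoint (Hc (lamOf s) x)) ∧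
      (∀ s : lamSubK η U₀ L k Eb, ‖s‖ ≤ α₄ / 4 → ∀ x, x ∉ Ω 0 → Hc (lamOf s) x = 0) ∧
      (∀ s : lamSubK η U₀ L k Eb, ‖s‖ ≤ α₄ / 4 → ∃ X : XSpace d k 𝔸,
        ‖X‖ ≤ α₄ / (2 * B₀') ∧ ‖X‖ ≤ Cb ∧
        (∀ (j : ℕ) (hj : j ≤ k) (y : Site d), y ∉ Λs j → X (⟨j, Nat.lt_succ_of_le hj⟩, y) = 0) ∧
        (∀ (j : ℕ) (hj : j ≤ k) (y : Site d), y ∈ Λs j →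
          Cfam j (((-I) • lamOf s + H' th) - H' X) y = X (⟨j, Nat.lt_succ_of_le hj⟩, y)) ∧
        Hc (lamOf s) = I • (H' th - H' X) ∧
        (-I) • (lamOf s + Hc (lamOf s)) = ((-I) • lamOf s + H' th) - H' X) ∧
      (∀ s : lamSubK η U₀ L k Eb, ‖s‖ ≤ α₄ / 4 → (∀ x, τ (lamOf s x) = 0) → ∀ x, τ (Hc (lamOf s) x) = 0) := by
  obtain ⟨Hc, hc0, hc1, hc2, hcL0, hcL1, hcL2, hcsa, hcsupp, hT⟩ := exists_Hc_of_family (Ω := Ω) (Λs := Λs) (Eb := Eb) (U₀ := U₀)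
    hL hη H' hα₄ hB hB₂ hCb hCl hEbT hH0 hH1 hH2 hHsupp hHequiv hC121 hC125 hCreal hCbρ hClB th hτ hth
  refine ⟨Hc, hc0, hc1, hc2, hcL0, hcL1, hcL2, hcsa, hcsupp, hT, fun s hs hsτ x => ?_⟩
  obtain ⟨X, hXρ, -, hXzero, hXfix, hHc, -⟩ := hT s hs
  have hXτ : ∀ p, τ (X p) = 0 := eq1117_solution_traceFree_fam (Λs := Λs) hL hη H' hα₄ hB hCb hEbT hH0 hH1 hC121 hC125 hCbρ hClB th
    hτ τ hHτ hthτ hCτ s hs hsτ hXρ hXzero hXfix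
  rw [hHc, Pi.smul_apply, Pi.sub_apply, map_smul, map_sub, hHτ th hthτ x, hHτ X hXτ x, sub_zero, smul_zero]

end HcTraceFree

/-! ## §3 Proposition 5's fixed point with the mixed restriction functional, the inhomogeneous target, AND `λ′` `τ`-free -/

section FamilyTraceFree

/-- ★★ **PROPOSITION 5's FIXED POINT WITH A MIXED RESTRICTION FUNCTIONAL, AN INHOMOGENEOUS TARGET, AND `λ′` `τ`-FREE** — ✓`hFP_kLevel_family_RD` (✓p632037) VERBATIM PLUS a
continuous tracial `τ` (`hτtr`), the lit base's τ-rows `hDAτ hRτ hGτ` (datum `D*A` on the `Ω_j`, letters `R`, `G′`), `H′` `τ`-compatible (`hHτ`), the target `t̂` `τ`-free (`hthτ`)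
and the family's τ-row `hCτ` (μ `τ`-free at every site + the two (1.120) antecedents on the `(j, y)`-box ⇒ `τ (Cfam j μ y) = 0`); CONCLUSION: the Prop.-5 fixed point `λ′`
(Hermitian, `= 0` off `Ω₀`, **`τ(λ′(x)) = 0` at every site**, (1.108) on `Eb j`, multiplier form of the Landau equation on `Ω₀`) with `Qfull j (−iλ′) y = t̂ (j, y)` for all
`j ≤ k`, `y ∈ Λs j`.  For `M_N(ℂ)`, `τ = tr`: `λ′` traceless, so `e^{iλ′} ∈ SU(N)` — the H-line's [R-f] `hlam` in `𝔰𝔲(2)`.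
[cite: Balaban1985RegularSpaces, Prop. 5 (1.107)–(1.109) p.94, (1.113)–(1.117) pp.95–96, (1.91)–(1.92) p.91, (1.17) p.78, p.76] -/
theorem hFP_kLevel_family_RD_traceFree (hL : 1 ≤ L) (hη : 0 < η) (hU₀ : ∀ x κ, U₀ x κ ∈ unitaryUnits 𝔸)
    (hEbΩ : ∀ j, j ≤ k → ∀ x ∈ Ω j, ∀ μ : Fin d, (x, μ) ∈ Eb j ∧ (x - e μ, μ) ∈ Eb j)
    (hEbT : ∀ j, j ≤ k → ∀ y ∈ Λs j, ∀ (x : Site d) (κ : Fin d), InBox (tlo L y j) (thi L y j) x →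
      InBox (tlo L y j) (thi L y j) (x + e κ) → (x, κ) ∈ Eb j)
    -- letters of [4] (RD form)
    (g Δ : (Site d → 𝔸) →ₗ[ℂ] (Site d → 𝔸)) (q : (Site d → 𝔸) →ₗ[ℂ] (ℕ → Site d → 𝔸)) (qs : (ℕ → Site d → 𝔸) →ₗ[ℂ] (Site d → 𝔸))
    (Aw c : (ℕ → Site d → 𝔸) →ₗ[ℂ] (ℕ → Site d → 𝔸))
    (g_rightΩ : ∀ x, ∀ y ∈ Ω 0, (Δ (g x) + qs (Aw (q (g x)))) y = x y)
    (c_range : ∀ f, q (g (g (qs (c (q f))))) = q f)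
    (hΔ : ∀ (f : Site d → 𝔸), ∀ x ∈ Ω 0, Δ f x = covLap η U₀ ((Ω 0).indicator f) x)
    (hqs : ∀ (μ : ℕ → Site d → 𝔸), ∀ x ∈ Ω 0, qs μ x = QT L k Λs U₀ μ x)
    -- the letter H′ of (1.91)–(1.92)
    (H' : XSpace d k 𝔸 →ₗ[ℂ] (Site d → 𝔸))
    {α₄ B₀' B₂' Cb Cl BG BR cA cDA : ℝ}
    (hα₄ : 0 < α₄) (hB : 0 < B₀') (hB₂ : 0 ≤ B₂') (hCb : 0 ≤ Cb) (hCl : 0 ≤ Cl)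
    (hH0 : ∀ (X : XSpace d k 𝔸) (x : Site d), ‖H' X x‖ ≤ B₀' * ‖X‖)
    (hH1 : ∀ j, j ≤ k → ∀ (X : XSpace d k 𝔸), ∀ p ∈ Eb j, wt L η j * ‖covDerivFwd η U₀ p.2 (H' X) p.1‖ ≤ B₀' * ‖X‖)
    (hH2 : ∀ X : XSpace d k 𝔸, Bd2 L η k Ω (covLap η U₀ (H' X)) (B₂' * ‖X‖))
    (hHsupp : ∀ (X : XSpace d k 𝔸) (x : Site d), x ∉ Ω 0 → H' X x = 0)
    (hHequiv : ∀ X Y : XSpace d k 𝔸, (∀ p, Y p = -star (X p)) → ∀ x, H' Y x = -star (H' X x))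
    -- the abstract remainder family: (1.121), (1.125), reality on the (1.120)-set of every tower
    (Cfam : ℕ → (Site d → 𝔸) → Site d → 𝔸)
    (hC121 : ∀ j, j ≤ k → ∀ y ∈ Λs j, ∀ μ : Site d → 𝔸,
      (∀ x : Site d, InBox (tlo L y j) (thi L y j) x → ‖μ x‖ < α₄) →
      (∀ (x : Site d) (κ : Fin d), InBox (tlo L y j) (thi L y j) x → InBox (tlo L y j) (thi L y j) (x + e κ) →
        ‖cj (U₀ x κ) (μ (x + e κ)) - μ x‖ < α₄ * ((L : ℝ) ^ j)⁻¹) →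
      ‖Cfam j μ y‖ ≤ Cb)
    (hC125 : ∀ j, j ≤ k → ∀ y ∈ Λs j, ∀ (μ₁ μ₂ : Site d → 𝔸) (m : ℝ), 0 ≤ m →
      (∀ x : Site d, InBox (tlo L y j) (thi L y j) x → ‖μ₁ x‖ < α₄) →
      (∀ (x : Site d) (κ : Fin d), InBox (tlo L y j) (thi L y j) x → InBox (tlo L y j) (thi L y j) (x + e κ) →
        ‖cj (U₀ x κ) (μ₁ (x + e κ)) - μ₁ x‖ < α₄ * ((L : ℝ) ^ j)⁻¹) →
      (∀ x : Site d, InBox (tlo L y j) (thi L y j) x → ‖μ₂ x‖ < α₄) →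
      (∀ (x : Site d) (κ : Fin d), InBox (tlo L y j) (thi L y j) x → InBox (tlo L y j) (thi L y j) (x + e κ) →
        ‖cj (U₀ x κ) (μ₂ (x + e κ)) - μ₂ x‖ < α₄ * ((L : ℝ) ^ j)⁻¹) →
      (∀ x : Site d, InBox (tlo L y j) (thi L y j) x → ‖(μ₁ - μ₂) x‖ ≤ m) →
      (∀ (x : Site d) (κ : Fin d), InBox (tlo L y j) (thi L y j) x → InBox (tlo L y j) (thi L y j) (x + e κ) →
        ‖cj (U₀ x κ) ((μ₁ - μ₂) (x + e κ)) - (μ₁ - μ₂) x‖ ≤ m * ((L : ℝ) ^ j)⁻¹) →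
      ‖Cfam j μ₁ y - Cfam j μ₂ y‖ ≤ Cl * m)
    (hCreal : ∀ j, j ≤ k → ∀ y ∈ Λs j, ∀ μ : Site d → 𝔸,
      (∀ x : Site d, InBox (tlo L y j) (thi L y j) x → ‖μ x‖ < α₄) →
      (∀ (x : Site d) (κ : Fin d), InBox (tlo L y j) (thi L y j) x → InBox (tlo L y j) (thi L y j) (x + e κ) →
        ‖cj (U₀ x κ) (μ (x + e κ)) - μ x‖ < α₄ * ((L : ℝ) ^ j)⁻¹) →
      Cfam j (fun x => -star (μ x)) y = -star (Cfam j μ y))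
    (hCbρ : Cb ≤ α₄ / (2 * B₀')) (hClB : Cl * B₀' ≤ 1 / 2)
    -- the target: skew, `B′₀‖t̂‖ < ¼α₄`
    (th : XSpace d k 𝔸) (hτ : B₀' * ‖th‖ < α₄ / 4) (hth : ∀ p, star (th p) = -th p)
    -- the split of the restriction functional: `Qfull = Qlin + Cfam`, `Qlin` additive with `Qlin (H′Y) = Y` and `Q′λ = 0 ⇒ Qlin (−iλ) = 0` on the index sites
    (Qfull Qlin : ℕ → (Site d → 𝔸) → Site d → 𝔸)
    (h213 : ∀ (j : ℕ), j ≤ k → ∀ y ∈ Λs j, ∀ μ : Site d → 𝔸, Qfull j μ y = Qlin j μ y + Cfam j μ y)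
    (hlin : ∀ (j : ℕ) (μ₁ μ₂ : Site d → 𝔸) (y : Site d), Qlin j (μ₁ - μ₂) y = Qlin j μ₁ y - Qlin j μ₂ y)
    (hQH : ∀ (Y : XSpace d k 𝔸) (j : ℕ) (hj : j ≤ k) (y : Site d), y ∈ Λs j → Qlin j (H' Y) y = Y (⟨j, Nat.lt_succ_of_le hj⟩, y))
    (hQlin0 : ∀ lam : Site d → 𝔸, q lam = 0 → ∀ (j : ℕ), j ≤ k → ∀ y ∈ Λs j, Qlin j ((-I) • lam) y = 0)
    -- JOIN-B's letters G′/R ((1.101), (1.98)R, range, reality), the datum, and its windows at the Sect. E sizes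
    (hBG : 0 ≤ BG) (hBR : 0 ≤ BR) (hcA : 0 ≤ cA) (hcA' : cA ≤ 1 / 13) (hcDA : 0 ≤ cDA)
    (ha₁' : α₄ / 4 + B₀' * (Cb + ‖th‖) ≤ 1 / 24) (hb₁' : α₄ / 4 + B₀' * (Cb + ‖th‖) ≤ 1 / 140)
    (hθ : 10 * (α₄ / 4 + B₀' * (Cb + ‖th‖)) * BR ≤ 1 / 2) (hh₀' : B₀' * (Cb + ‖th‖) ≤ 3 * α₄ / 4)
    (hG : ∀ (f : Site d → 𝔸) (m : ℝ), 0 ≤ m → Bd2 L η k Ω f m →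
      (∀ x, ‖g f x‖ ≤ BG * m) ∧ ∀ j, j ≤ k → ∀ p ∈ Eb j, wt L η j * ‖covDerivFwd η U₀ p.2 (g f) p.1‖ ≤ BG * m)
    (hGsupp : ∀ (f : Site d → 𝔸) (x : Site d), x ∉ Ω 0 → g f x = 0)
    (hGreal : ∀ f : Site d → 𝔸, (∀ j, j ≤ k → ∀ x ∈ Ω j, IsSelfAdjoint (f x)) → ∀ x, IsSelfAdjoint (g f x))
    (hRbd : ∀ (f : Site d → 𝔸) (m : ℝ), 0 ≤ m → Bd2 L η k Ω f m → Bd2 L η k Ω (f - g (qs (c (q (g f))))) (BR * m))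
    (hRreal : ∀ f : Site d → 𝔸, (∀ j, j ≤ k → ∀ x ∈ Ω j, IsSelfAdjoint (f x)) →
      ∀ j, j ≤ k → ∀ x ∈ Ω j, IsSelfAdjoint ((f - g (qs (c (q (g f))))) x))
    (hDA : Bd2 L η k Ω (fun y => covDivB η U₀ A y) cDA) (hDAsa : ∀ j, j ≤ k → ∀ x ∈ Ω j, IsSelfAdjoint (covDivB η U₀ A x))
    (hA : ∀ j, j ≤ k → ∀ x ∈ Ω j, ∀ μ : Fin d,
      wt L η j * ‖A x μ‖ ≤ cA ∧ wt L η j * ‖conjR (U₀ (x - e μ) μ)⁻¹ (A (x - e μ) μ)‖ ≤ cA)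
    (hAsa : ∀ x μ, IsSelfAdjoint (A x μ))
    (h103 : BG * Mc d BR (α₄ / 4 + B₀' * (Cb + ‖th‖)) cA (B₂' * (Cb + ‖th‖)) cDA ≤ α₄ / 4)
    (h106 : BG * Kc d BR (α₄ / 4 + B₀' * (Cb + ‖th‖)) cA (B₂' * (Cb + ‖th‖)) cDA (B₂' * (2 * Cl)) (1 + B₀' * (2 * Cl)) (1 + B₀' * (2 * Cl))
      ≤ 1 / 2)
    -- `τ` tracial and the τ-rows: datum, letters (lit base), `H′`, the target, the family's τ-row on the (1.120)-set of every tower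
    (τ : 𝔸 →L[ℂ] ℂ) (hτtr : ∀ x y : 𝔸, τ (x * y) = τ (y * x))
    (hDAτ : ∀ j, j ≤ k → ∀ x ∈ Ω j, τ (covDivB η U₀ A x) = 0)
    (hRτ : ∀ f : Site d → 𝔸, (∀ j, j ≤ k → ∀ x ∈ Ω j, τ (f x) = 0) →
      ∀ j, j ≤ k → ∀ x ∈ Ω j, τ ((f - g (qs (c (q (g f))))) x) = 0)
    (hGτ : ∀ f : Site d → 𝔸, (∀ j, j ≤ k → ∀ x ∈ Ω j, τ (f x) = 0) → ∀ x, τ (g f x) = 0)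
    (hHτ : ∀ X : XSpace d k 𝔸, (∀ p, τ (X p) = 0) → ∀ x, τ (H' X x) = 0)
    (hthτ : ∀ p, τ (th p) = 0)
    (hCτ : ∀ j, j ≤ k → ∀ y ∈ Λs j, ∀ μ : Site d → 𝔸, (∀ x, τ (μ x) = 0) →
      (∀ x : Site d, InBox (tlo L y j) (thi L y j) x → ‖μ x‖ < α₄) →
      (∀ (x : Site d) (κ : Fin d), InBox (tlo L y j) (thi L y j) x → InBox (tlo L y j) (thi L y j) (x + e κ) →
        ‖cj (U₀ x κ) (μ (x + e κ)) - μ x‖ < α₄ * ((L : ℝ) ^ j)⁻¹) →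
      τ (Cfam j μ y) = 0) :
    ∃ lam : Site d → 𝔸, (∀ x, IsSelfAdjoint (lam x)) ∧ (∀ x, x ∉ Ω 0 → lam x = 0) ∧ (∀ x, τ (lam x) = 0) ∧
      (∀ j, j ≤ k → ∀ p ∈ Eb j, ‖lam p.1‖ ≤ α₄ ∧ wt L η j * ‖covDerivFwd η U₀ p.2 lam p.1‖ ≤ α₄) ∧
      (∃ μ : ℕ → Site d → 𝔸, ∀ x ∈ Ω 0,
        covLap η U₀ ((Ω 0).indicator fun y => covDivB η U₀ A y + covLap η U₀ lam y +
          ((conjR (gaugeExp lam y)⁻¹ (covDivB η U₀ A y) - covDivB η U₀ A y) +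
            (gAd (covLap η U₀ lam y) (lam y) - covLap η U₀ lam y) + ∑ μ, frakF3 η U₀ lam A y μ)) x = QT L k Λs U₀ μ x) ∧
      ∀ (j : ℕ) (hj : j ≤ k) (y : Site d), y ∈ Λs j → Qfull j ((-I) • lam) y = th (⟨j, Nat.lt_succ_of_le hj⟩, y) := by
  -- ★w8 s2's J4b: the Sect. E correction of the family with its eight binders and the transfer (1.117)
  obtain ⟨Hc, hc0, hc1, hc2, hcL0, hcL1, hcL2, hcsa, hcsupp, hT, hcτ⟩ := exists_Hc_of_family_traceFree (Ω := Ω) (Λs := Λs) (Eb := Eb)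
    (U₀ := U₀) hL hη H' hα₄ hB hB₂ hCb hCl hEbT hH0 hH1 hH2 hHsupp hHequiv hC121 hC125 hCreal hCbρ hClB th hτ hth τ hHτ hthτ hCτ
  have hh₀ : 0 ≤ B₀' * (Cb + ‖th‖) := mul_nonneg hB.le (add_nonneg hCb (norm_nonneg _))
  have hh₂ : 0 ≤ B₂' * (Cb + ‖th‖) := mul_nonneg hB₂ (add_nonneg hCb (norm_nonneg _))
  have hl₀ : 0 ≤ B₀' * (2 * Cl) := by positivity
  have hl₂ : 0 ≤ B₂' * (2 * Cl) := by positivity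
  have hb₁ : 0 < α₄ / 4 + B₀' * (Cb + ‖th‖) := by positivity
  -- the restriction-agnostic JOIN-B at `P := Qfull (−iλ′) = t̂ on 𝔅_k`
  refine hFP_kLevel_ofConstraint_RD_traceFree hL hη hU₀ hEbΩ g Δ q qs Aw c g_rightΩ c_range hΔ hqs Hc hα₄ hBG hBR hh₀ hh₂ hl₀ hl₀ hl₂ hcA hcA'
    hcDA ha₁' hb₁' hb₁ hθ hh₀' hh₀' hG hGsupp hGreal hRbd hRreal hc0 hc1 hc2 hcL0 hcL1 hcL2 hcsa hcsupp hDA hDAsa hA hAsa h103 h106 τ hτtr hDAτ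
    hcτ hRτ hGτ (fun lam => ∀ (j : ℕ) (hj : j ≤ k) (y : Site d), y ∈ Λs j → Qfull j ((-I) • lam) y = th (⟨j, Nat.lt_succ_of_le hj⟩, y)) ?_
  -- the transfer: (1.117) for the family ⇒ (1.114) with the shifted base point ⇒ `Qfull (−iλ′) = Qlin (−iλ_s) + t̂ = t̂`
  intro s hs hq j hj y hy
  obtain ⟨X, -, -, -, hfix, -, hlamE⟩ := hT s hs
  rw [hlamE]
  have h114 := eq1114_of_fixedPoint_kLevel_fam (Λ := Λs) (H' := H') (lam := (-I) • lamOf s + H' th) (Cfam := Cfam) Qfull Qlin h213 hlin hQH hfix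
    j hj y hy
  rw [h114, qlin_add_of_sub Qlin hlin, hQH th j hj y hy, hQlin0 (lamOf s) hq j hj y hy, zero_add]

end FamilyTraceFree

end Summit.QuantumFields.YangMills.Theorems.HalvingP1FlatCoreTopStep

end
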